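import Literature.MathematicalPhysics.QuantumFieldTheory.Balaban1983to89.B9Eq326ConjugatedDeltaAEnergyWeight
import Literature.MathematicalPhysics.QuantumFieldTheory.Balaban1983to89.B9Eq326ConjugatedDeltaAFormDefect

/-!
# `Balaban1983to89.B9Eq326ConjugatedDeltaATwoBackgrounds` — T. Bałaban, *Propagators for lattice gauge theories in a background field*, Commun. Math. Phys.
# **99** (1985) 389–434 [Balaban1985BackgroundPropagators] (3.26) p. 395, (3.21)∕(3.24) p. 394, (3.49) p. 399, (3.52)–(3.53) and Thm 3.4 p. 400, (3.84)–(3.86)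
# p. 407, Thm 3.11 p. 416 with [Balaban1985Variational] (110) p. 294: **THE TWO-BACKGROUND DIFFERENCE OF THE CONJUGATED `Δ_a`-INVERSES FROM PRIMITIVE
# LETTERS — `‖G_κ(V)y − G_κ(U)y‖ ≤ (Θ∕γ′)·(1 + δ_N)∕γ′·‖y‖`, `γ′ = min(¼, γ∕8)`, `Θ` LINEAR (at leading order) in the CONJUGATED difference letters
# `δ₁, δ₂, δ_R, δ_Q, δ_K`, `δ_N = d₁ + d₂ + d_R(1+C_P) + √a·d_Q`, from (CDA)'s binder list AT `U` AND AT `V`** — abstract finite-dimensional `𝕜`-Hilbert letters; the END of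
# road (α) of t4-ne9-idea-1's N52 («the two-background difference of the bond propagator WITH decay»), abstract half

statement-level skeleton of published theorems with citation tags; proofs where landed; nothing here is a claim about the Yang–Mills mass gap

CITATION HEADER (lean-in-tree rule).  Audit cell `pub-balaban`, sub-cell `t4`, BINDER row NE9; filed by NE9 formalisation-swarm LEAF PROVER 01
(`b2b-balaban-t4-ne9-formalise-leaf-01`, gen 88) under the fallback offer O-leaf01-g88-1 on t4-ne9-idea-1 gen 151's located note N52 road (α) (cell journal
2026-08-25 l.62985; card `t4/ideate/NE9/lens1-g151/N52-TWOBG-DECAY-g151.md`).  Imports this lineage's `B9Eq326ConjugatedDeltaAEnergyWeight` (weight letters,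
`coerciveN_k`, `norm_rightInv_sub_rightInv_le_of_coercive`) and `B9Eq326ConjugatedDeltaAFormDefect` (`norm_adjoint_sub_le_of_norm_sub_adjoint_le`,
`norm_adjoint_sub_adjoint_le`, `norm_inner_conjH_sub_conjH_le`, `weightU_le_weightV_mul`).  Sources READ first-hand in the held text layer
(`paper:balaban1985-cmp99-background-propagators`, journal page = PDF page + 388): p. 395 (3.26), p. 394 (3.21)∕(3.24), p. 399 (3.49), p. 400 (3.52)–(3.53)
*«Δ_{U′U} = Δ_U − V₁(A)»* and Thm 3.4 *«the operators G′(U), (Q′(U)G′²(U)Q′*(U))⁻¹, R(U), G(U) extend to configurations U′U … we prove quantitative statements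
which are more precise, describing these analytic extensions as small perturbations of the operators depending on U only»*, p. 407 (3.86) *«G(U′U) =
G(U)(I − V(A)G(U))⁻¹»*, p. 416 Thm 3.11; [Balaban1985Variational] p. 294 (110).  Print's perturbation in the background is the Neumann series (3.86) and its
decay proof is the random walk of Sect. C; the conjugation `e^{κχ}(·)e^{−κχ}` and the energy-norm argument are the ROUTE's (`t4/ROUTES-NE9.md` §L1.2 R2′ road
B8″, §L1.4 EXAMINED gen 151 N52); nothing of print's rate or radius is asserted.

WHY THIS FILE (N52 road (α), ASSEMBLY).  (CDT) `B9Eq326ConjugatedDeltaATower.norm_conjG1k_le` gives ONE-background decay of the bond propagator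
(`‖S∘G₁,k(U)∘S⁻¹‖ ≤ 4∕γ`, read out by `B9Eq349BondBlockDecayFromCircle`); ne9-leaf-04's `B9Eq386GreenkLipschitzEnergy(Pi)TwoBackgrounds` give TWO-background
rows WITHOUT decay.  Road (α) joins them: `S(G₁,k(V) − G₁,k(U))S⁻¹ = G_κ(V) − G_κ(U)` with `G_κ(X) := S∘G₁,k(X)∘S⁻¹` a right inverse of
`H_κ(X) := S∘Δ_{a,k}(X)∘S⁻¹` ((CDT) `conjDeltaAk_conjInv`), and `‖G_κ(V)y − G_κ(U)y‖ ≤ (Θ∕γ′)C₀‖y‖` follows from the energy-keeping coercivity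
(`…EnergyWeight` §1–§2), the conjugated form defect (`…FormDefect` §2) and the weight comparison (`…FormDefect` §3).  THIS file discharges the form defect's
size letters from (CDA)'s primitive conjugation letters `β, ρ, C_P` in the weight `N_U` (§1) and assembles the END from (CDA) §2's binder list at `U` and at
`V` plus the two-background letters (§2).  Uniformly over the Combes–Thomas circle `‖κ‖ = r` the END is the `hC` letter of ne9-leaf-03's
`B9Eq349BondBlockDecayFromCircle.norm_bondBlock_le_exp_of_uniform_circle_bound` for `T := G₁,k(V) − G₁,k(U)`: block decay of the two-background difference
with a constant `∝ δ` — the read-out and the lattice letters ((CDT)'s binders twice, ne9-leaf-04's closeness letters, the conjugation of the LOCAL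
zeroth-order differences `B_i(V) − B_i(U)`) are the junction's lines, NOT here.

WHAT IS PROVED (sorry-free; proof lane — no `def`; [folklore] finite-dimensional Hilbert-space algebra).
* §1 the letters of `…FormDefect.norm_inner_conjH_sub_conjH_le` for `N = N_U(f) = √(‖B₁f‖² + ‖R(B₂f)‖² + a‖Qf‖² + ‖f‖²)` from (CDA)'s primitive ones:
  `norm_B₁k_le_weightU`, `norm_adjoint_B₁k'_le_weightU` (`(1+β)N_U`), `norm_B₂k_le_weightU`, `norm_adjoint_B₂k'_le_weightU` (`(1+C_P+β)N_U`),
  `norm_Rk_B₂k_le_weightU` (`(1+ρ)(1+C_P+β)N_U`), `abs_mul_norm_Qk_le_weightU`, `abs_mul_norm_adjoint_Qk'_le_weightU` (`|a|‖Q_κv‖, |a|‖Q′_κ†u‖ ≤ (√a + |a|β)N_U`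
  — the coupling carried by the size letter, `a = 0` harmless), and the composite difference **`norm_Rk_B₂k_sub_le_weightU`**
  (`‖R_κ(V)B_{2,κ}(V)v − R_κ(U)B_{2,κ}(U)v‖ ≤ ((1+ρ)δ₂ + δ_R(1+C_P+β))N_U(v)`).
* §2 **`norm_inner_conjH_sub_conjH_le_weightU`** (the form defect `Θ` in `N_U` from primitive letters — §1's letters through `…FormDefect` §2; also
  the `hD` letter of the linear pencil `H_κ(U) + z(H_κ(V) − H_κ(U))`) and THE END **`norm_conjGk_sub_conjGk_le`** — from (CDA) §2's binder list at `U` and at `V` (ONE set of scalar letters `a, γ, β, β_K, p_K, ρ, C_P`; the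
  energy window `¾p_K + (21 + 3a)β² + 4βC_P + 2ρC_P² + β_K ≤ γ∕8` of `…EnergyWeight`), right inverses `H_κ(X)G_κ(X) = 1`, the eight CONJUGATED difference
  letters (`δ₁, δ₂, δ_R, δ_Q, δ_K`) and the four UNconjugated ZEROTH-order ones (`d₁, d₂, d_R, d_Q`):
  `‖G_κ(V)y − G_κ(U)y‖ ≤ (Θ∕γ′)·((1 + δ_N)·γ′⁻¹)·‖y‖`, `γ′ = min(¼, γ∕8)`, `δ_N = d₁ + d₂ + d_R(1 + C_P) + √a·d_Q`,
  `Θ = [(1+β)δ₁ + δ₁(1+β) + δ₁²] + [(1+C_P+β)·e₂ + δ₂(1+ρ)(1+C_P+β) + δ₂e₂] + δ_K + [(√a+|a|β)δ_Q + δ_Q(√a+|a|β) + |a|δ_Q²]`,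
  `e₂ = (1+ρ)δ₂ + δ_R(1+C_P+β)` — displayed literally, NOT simplified.
MODEL ∕ HONEST SCOPE.  (M1) abstract letters; finite-dimensional spaces; `a ≥ 0`.  (M2) DISPLAYED: `γ` (Thm 3.11's coercivity of `Δ_a` at `U` and at `V`, NOT
proved in the tree) and every (CDA) letter at both backgrounds; the conjugated AND unconjugated two-background difference letters (their lattice suppliers —
ne9-leaf-04's closeness letters, a `B9Eq3101ConjugationLetters*`-type conjugation of a LOCAL difference, `B9Eq368RLipschitzTowerTwoBackgrounds` conjugated —
are NOT here).  (M3) first order in `V − U` (road (α)); crude constants (`γ′` twice, `(1+ρ)(1+C_P+β)`).  (M4) no lattice object, no rate, no window evaluated;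
road (β) (Cauchy on the complexified background pencil) untouched.  NOT NE9 (cell pub-balaban: NE9 NOT PRINTED ∕ NOT PROVED; «NE9 ⇐ the named binders»; row
WALLED ON A MODEL (O-NE9-1; #5 UNRULED); spine PROVED 0∕9; rung (B)+1 on a finite T⁴ — NOT infinite volume, NOT mass gap, NOT BetaPertH, NOT Clay).  HONEST
DEPENDENCY (cell line): continuum YM on T⁴ ⇐ BetaPertH ∧ nine spine estimates (0/9 proved); BetaPertH ⇐ (D1) ∧ (D4) ∧ CAP+tail; G-an2-4 gates asym, D1 and
NE2/3/4.  NEW file; nothing modified.  Net new unproved facts: 0.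
-/

noncomputable section

open scoped InnerProductSpace ComplexConjugate

namespace Literature.MathematicalPhysics.QuantumFieldTheory.Balaban1983to89.B9Eq326ConjugatedDeltaATwoBackgrounds

open B9Eq326ConjugatedDeltaAEnergyWeight (weightU_nonneg norm_le_weightU norm_B₁_le_weightU norm_RB₂_le_weightU sqrt_mul_norm_Q_le_weightU coerciveN_k
  norm_rightInv_sub_rightInv_le_of_coercive)
open B9Eq326ConjugatedDeltaAFormDefect (norm_adjoint_sub_le_of_norm_sub_adjoint_le norm_adjoint_sub_adjoint_le norm_inner_conjH_sub_conjH_le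
  weightU_le_weightV_mul)

variable {𝕜 : Type*} [RCLike 𝕜]
  {E : Type*} [NormedAddCommGroup E] [InnerProductSpace 𝕜 E] [FiniteDimensional 𝕜 E]
  {P : Type*} [NormedAddCommGroup P] [InnerProductSpace 𝕜 P] [FiniteDimensional 𝕜 P]
  {S : Type*} [NormedAddCommGroup S] [InnerProductSpace 𝕜 S] [FiniteDimensional 𝕜 S]
  {F : Type*} [NormedAddCommGroup F] [InnerProductSpace 𝕜 F] [FiniteDimensional 𝕜 F]

/-! ## §1 The letters of the form defect for `N = N_U`, from (CDA)'s primitive ones -/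

section LettersU

variable (B₁ : E →ₗ[𝕜] P) (B₂ : E →ₗ[𝕜] S) (R : S →ₗ[𝕜] S) (Q : E →ₗ[𝕜] F) (a β ρ CP : ℝ)
  (B₁k : E →ₗ[𝕜] P) (B₁k' : P →ₗ[𝕜] E) (B₂k : E →ₗ[𝕜] S) (B₂k' : S →ₗ[𝕜] E) (Rk : S →ₗ[𝕜] S) (Qk : E →ₗ[𝕜] F) (Qk' : F →ₗ[𝕜] E)
  (ha : 0 ≤ a) (hβ : 0 ≤ β) (hρ : 0 ≤ ρ) (hCP : 0 ≤ CP) (hR1 : ∀ s, ‖R s‖ ≤ ‖s‖)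
  (dB₁ : ∀ f, ‖B₁k f - B₁ f‖ ≤ β * ‖f‖) (dB₁' : ∀ p, ‖B₁k' p - LinearMap.adjoint B₁ p‖ ≤ β * ‖p‖)
  (dB₂ : ∀ f, ‖B₂k f - B₂ f‖ ≤ β * ‖f‖) (dB₂' : ∀ s, ‖B₂k' s - LinearMap.adjoint B₂ s‖ ≤ β * ‖s‖)
  (dR : ∀ s, ‖Rk s - R s‖ ≤ ρ * ‖s‖)
  (dQ : ∀ f, ‖Qk f - Q f‖ ≤ β * ‖f‖) (dQ' : ∀ g, ‖Qk' g - LinearMap.adjoint Q g‖ ≤ β * ‖g‖)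
  (hP : ∀ f, ‖B₂ f - R (B₂ f)‖ ≤ CP * ‖f‖)

omit [FiniteDimensional 𝕜 E] [FiniteDimensional 𝕜 P] [FiniteDimensional 𝕜 S] [FiniteDimensional 𝕜 F] in
include ha hβ dB₁ in
/-- `‖B_{1,κ}(U)v‖ ≤ (1+β)·N_U(v)` (the conjugated curl against its unconjugated component of the weight). [folklore]
[cite: Balaban1985BackgroundPropagators, (3.49) p.399, (3.26) p.395] -/
theorem norm_B₁k_le_weightU (v : E) : ‖B₁k v‖ ≤ (1 + β) * Real.sqrt (‖B₁ v‖ ^ 2 + ‖R (B₂ v)‖ ^ 2 + a * ‖Q v‖ ^ 2 + ‖v‖ ^ 2) := by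
  have h1 := norm_B₁_le_weightU B₁ B₂ R Q a ha (𝕜 := 𝕜) v
  have h2 := norm_le_weightU B₁ B₂ R Q a ha (𝕜 := 𝕜) v
  have h3 : ‖B₁k v‖ ≤ ‖B₁ v‖ + ‖B₁k v - B₁ v‖ := by
    have := norm_add_le (B₁ v) (B₁k v - B₁ v); rwa [add_sub_cancel] at this
  nlinarith [dB₁ v, mul_le_mul_of_nonneg_left h2 hβ]

omit [FiniteDimensional 𝕜 S] [FiniteDimensional 𝕜 F] in
include ha hβ dB₁' in
/-- `‖B′_{1,κ}(U)†u‖ ≤ (1+β)·N_U(u)` (adjoint transfer of `‖B′_{1,κ} − B₁†‖ ≤ β`). [folklore] [cite: Balaban1985BackgroundPropagators, (3.49) p.399, (3.24) p.394] -/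
theorem norm_adjoint_B₁k'_le_weightU (u : E) :
    ‖LinearMap.adjoint B₁k' u‖ ≤ (1 + β) * Real.sqrt (‖B₁ u‖ ^ 2 + ‖R (B₂ u)‖ ^ 2 + a * ‖Q u‖ ^ 2 + ‖u‖ ^ 2) := by
  have h1 := norm_B₁_le_weightU B₁ B₂ R Q a ha (𝕜 := 𝕜) u
  have h2 := norm_le_weightU B₁ B₂ R Q a ha (𝕜 := 𝕜) u
  have h3 : ‖LinearMap.adjoint B₁k' u‖ ≤ ‖B₁ u‖ + ‖LinearMap.adjoint B₁k' u - B₁ u‖ := by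
    have := norm_add_le (B₁ u) (LinearMap.adjoint B₁k' u - B₁ u); rwa [add_sub_cancel] at this
  have h4 := norm_adjoint_sub_le_of_norm_sub_adjoint_le hβ dB₁' u
  nlinarith [mul_le_mul_of_nonneg_left h2 hβ]

omit [FiniteDimensional 𝕜 E] [FiniteDimensional 𝕜 P] [FiniteDimensional 𝕜 S] [FiniteDimensional 𝕜 F] in
include ha hβ hCP dB₂ hP in
/-- `‖B_{2,κ}(U)v‖ ≤ (1+C_P+β)·N_U(v)` (the weight carries only the PROJECTED divergence; the complementary part costs `C_P`). [folklore]
[cite: Balaban1985BackgroundPropagators, (3.49) p.399, (3.21) p.394, (3.26) p.395] -/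
theorem norm_B₂k_le_weightU (v : E) : ‖B₂k v‖ ≤ (1 + CP + β) * Real.sqrt (‖B₁ v‖ ^ 2 + ‖R (B₂ v)‖ ^ 2 + a * ‖Q v‖ ^ 2 + ‖v‖ ^ 2) := by
  have h1 := norm_RB₂_le_weightU B₁ B₂ R Q a ha (𝕜 := 𝕜) v
  have h2 := norm_le_weightU B₁ B₂ R Q a ha (𝕜 := 𝕜) v
  have h3 : ‖B₂k v‖ ≤ ‖B₂ v‖ + ‖B₂k v - B₂ v‖ := by
    have := norm_add_le (B₂ v) (B₂k v - B₂ v); rwa [add_sub_cancel] at this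
  have h4 : ‖B₂ v‖ ≤ ‖R (B₂ v)‖ + ‖B₂ v - R (B₂ v)‖ := by
    have := norm_add_le (R (B₂ v)) (B₂ v - R (B₂ v)); rwa [add_sub_cancel] at this
  nlinarith [dB₂ v, hP v, mul_le_mul_of_nonneg_left h2 hβ, mul_le_mul_of_nonneg_left h2 hCP]

omit [FiniteDimensional 𝕜 P] [FiniteDimensional 𝕜 F] in
include ha hβ hCP dB₂' hP in
/-- `‖B′_{2,κ}(U)†u‖ ≤ (1+C_P+β)·N_U(u)`. [folklore] [cite: Balaban1985BackgroundPropagators, (3.49) p.399, (3.21) p.394, (3.24) p.394] -/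
theorem norm_adjoint_B₂k'_le_weightU (u : E) :
    ‖LinearMap.adjoint B₂k' u‖ ≤ (1 + CP + β) * Real.sqrt (‖B₁ u‖ ^ 2 + ‖R (B₂ u)‖ ^ 2 + a * ‖Q u‖ ^ 2 + ‖u‖ ^ 2) := by
  have h1 := norm_RB₂_le_weightU B₁ B₂ R Q a ha (𝕜 := 𝕜) u
  have h2 := norm_le_weightU B₁ B₂ R Q a ha (𝕜 := 𝕜) u
  have h3 : ‖LinearMap.adjoint B₂k' u‖ ≤ ‖B₂ u‖ + ‖LinearMap.adjoint B₂k' u - B₂ u‖ := by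
    have := norm_add_le (B₂ u) (LinearMap.adjoint B₂k' u - B₂ u); rwa [add_sub_cancel] at this
  have h4 : ‖B₂ u‖ ≤ ‖R (B₂ u)‖ + ‖B₂ u - R (B₂ u)‖ := by
    have := norm_add_le (R (B₂ u)) (B₂ u - R (B₂ u)); rwa [add_sub_cancel] at this
  have h5 := norm_adjoint_sub_le_of_norm_sub_adjoint_le hβ dB₂' u
  nlinarith [hP u, mul_le_mul_of_nonneg_left h2 hβ, mul_le_mul_of_nonneg_left h2 hCP]

omit [FiniteDimensional 𝕜 E] [FiniteDimensional 𝕜 P] [FiniteDimensional 𝕜 S] [FiniteDimensional 𝕜 F] in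
include ha hβ hρ hCP hR1 dB₂ dR hP in
/-- `‖R_κ(U)(B_{2,κ}(U)v)‖ ≤ (1+ρ)(1+C_P+β)·N_U(v)`. [folklore] [cite: Balaban1985BackgroundPropagators, (3.49) p.399, (3.21) p.394, (3.26) p.395] -/
theorem norm_Rk_B₂k_le_weightU (v : E) :
    ‖Rk (B₂k v)‖ ≤ (1 + ρ) * (1 + CP + β) * Real.sqrt (‖B₁ v‖ ^ 2 + ‖R (B₂ v)‖ ^ 2 + a * ‖Q v‖ ^ 2 + ‖v‖ ^ 2) := by
  have h1 := norm_B₂k_le_weightU B₁ B₂ R Q a β CP B₂k ha hβ hCP dB₂ hP (𝕜 := 𝕜) v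
  have h2 : ‖Rk (B₂k v)‖ ≤ (1 + ρ) * ‖B₂k v‖ := by
    have := norm_add_le (R (B₂k v)) (Rk (B₂k v) - R (B₂k v)); rw [add_sub_cancel] at this
    nlinarith [hR1 (B₂k v), dR (B₂k v)]
  exact h2.trans (by rw [mul_assoc]; exact mul_le_mul_of_nonneg_left h1 (by linarith))

omit [FiniteDimensional 𝕜 E] [FiniteDimensional 𝕜 P] [FiniteDimensional 𝕜 S] [FiniteDimensional 𝕜 F] in
include ha hβ dQ in
/-- `|a|·‖Q_κ(U)v‖ ≤ (√a + |a|β)·N_U(v)` — the coupling is carried by the size letter, so that `a = 0` is harmless. [folklore]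
[cite: Balaban1985BackgroundPropagators, (3.49) p.399, (3.15) p.393, (3.26) p.395] -/
theorem abs_mul_norm_Qk_le_weightU (v : E) :
    |a| * ‖Qk v‖ ≤ (Real.sqrt a + |a| * β) * Real.sqrt (‖B₁ v‖ ^ 2 + ‖R (B₂ v)‖ ^ 2 + a * ‖Q v‖ ^ 2 + ‖v‖ ^ 2) := by
  have h1 := sqrt_mul_norm_Q_le_weightU B₁ B₂ R Q a ha (𝕜 := 𝕜) v
  have h2 := norm_le_weightU B₁ B₂ R Q a ha (𝕜 := 𝕜) v
  have h3 : ‖Qk v‖ ≤ ‖Q v‖ + ‖Qk v - Q v‖ := by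
    have := norm_add_le (Q v) (Qk v - Q v); rwa [add_sub_cancel] at this
  rw [abs_of_nonneg ha]
  have h4 : a * ‖Q v‖ ≤ Real.sqrt a * Real.sqrt (‖B₁ v‖ ^ 2 + ‖R (B₂ v)‖ ^ 2 + a * ‖Q v‖ ^ 2 + ‖v‖ ^ 2) :=
    calc a * ‖Q v‖ = Real.sqrt a * (Real.sqrt a * ‖Q v‖) := by rw [← mul_assoc, Real.mul_self_sqrt ha]
      _ ≤ Real.sqrt a * Real.sqrt (‖B₁ v‖ ^ 2 + ‖R (B₂ v)‖ ^ 2 + a * ‖Q v‖ ^ 2 + ‖v‖ ^ 2) := mul_le_mul_of_nonneg_left h1 (Real.sqrt_nonneg _)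
  have h5 : a * ‖Qk v - Q v‖ ≤ a * β * Real.sqrt (‖B₁ v‖ ^ 2 + ‖R (B₂ v)‖ ^ 2 + a * ‖Q v‖ ^ 2 + ‖v‖ ^ 2) := by
    rw [mul_assoc]; exact mul_le_mul_of_nonneg_left ((dQ v).trans (mul_le_mul_of_nonneg_left h2 hβ)) ha
  nlinarith [mul_le_mul_of_nonneg_left h3 ha]

omit [FiniteDimensional 𝕜 P] [FiniteDimensional 𝕜 S] in
include ha hβ dQ' in
/-- `|a|·‖Q′_κ(U)†u‖ ≤ (√a + |a|β)·N_U(u)` (adjoint transfer of `‖Q′_κ − Q†‖ ≤ β`). [folklore] [cite: Balaban1985BackgroundPropagators, (3.49) p.399, (3.24) p.394] -/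
theorem abs_mul_norm_adjoint_Qk'_le_weightU (u : E) :
    |a| * ‖LinearMap.adjoint Qk' u‖ ≤ (Real.sqrt a + |a| * β) * Real.sqrt (‖B₁ u‖ ^ 2 + ‖R (B₂ u)‖ ^ 2 + a * ‖Q u‖ ^ 2 + ‖u‖ ^ 2) := by
  have h1 := sqrt_mul_norm_Q_le_weightU B₁ B₂ R Q a ha (𝕜 := 𝕜) u
  have h2 := norm_le_weightU B₁ B₂ R Q a ha (𝕜 := 𝕜) u
  have h3 : ‖LinearMap.adjoint Qk' u‖ ≤ ‖Q u‖ + ‖LinearMap.adjoint Qk' u - Q u‖ := by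
    have := norm_add_le (Q u) (LinearMap.adjoint Qk' u - Q u); rwa [add_sub_cancel] at this
  have h6 := norm_adjoint_sub_le_of_norm_sub_adjoint_le hβ dQ' u
  rw [abs_of_nonneg ha]
  have h4 : a * ‖Q u‖ ≤ Real.sqrt a * Real.sqrt (‖B₁ u‖ ^ 2 + ‖R (B₂ u)‖ ^ 2 + a * ‖Q u‖ ^ 2 + ‖u‖ ^ 2) :=
    calc a * ‖Q u‖ = Real.sqrt a * (Real.sqrt a * ‖Q u‖) := by rw [← mul_assoc, Real.mul_self_sqrt ha]
      _ ≤ Real.sqrt a * Real.sqrt (‖B₁ u‖ ^ 2 + ‖R (B₂ u)‖ ^ 2 + a * ‖Q u‖ ^ 2 + ‖u‖ ^ 2) := mul_le_mul_of_nonneg_left h1 (Real.sqrt_nonneg _)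
  have h5 : a * ‖LinearMap.adjoint Qk' u - Q u‖ ≤ a * β * Real.sqrt (‖B₁ u‖ ^ 2 + ‖R (B₂ u)‖ ^ 2 + a * ‖Q u‖ ^ 2 + ‖u‖ ^ 2) := by
    rw [mul_assoc]; exact mul_le_mul_of_nonneg_left (h6.trans (mul_le_mul_of_nonneg_left h2 hβ)) ha
  nlinarith [mul_le_mul_of_nonneg_left h3 ha]

omit [FiniteDimensional 𝕜 E] [FiniteDimensional 𝕜 P] [FiniteDimensional 𝕜 S] [FiniteDimensional 𝕜 F] in
include ha hβ hρ hCP dB₂ hP in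
/-- **THE COMPOSITE DIFFERENCE LETTER `e₂`**: with `V`'s projection letters `‖R(V)s‖ ≤ ‖s‖`, `‖R_κ(V) − R(V)‖ ≤ ρ` and the conjugated two-background letters
`‖B_{2,κ}(V) − B_{2,κ}(U)‖ ≤ δ₂`, `‖R_κ(V) − R_κ(U)‖ ≤ δ_R`:
`‖R_κ(V)(B_{2,κ}(V)v) − R_κ(U)(B_{2,κ}(U)v)‖ ≤ ((1+ρ)δ₂ + δ_R(1+C_P+β))·N_U(v)` — `R_κ(V)(B_{2,κ}(V) − B_{2,κ}(U))v + (R_κ(V) − R_κ(U))(B_{2,κ}(U)v)`. [folklore]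
[cite: Balaban1985BackgroundPropagators, (3.52)–(3.53) p.400, (3.21) p.394, (3.49) p.399] -/
theorem norm_Rk_B₂k_sub_le_weightU {RV RkV : S →ₗ[𝕜] S} {B₂kV : E →ₗ[𝕜] S} {δ₂ δR : ℝ} (hδ₂ : 0 ≤ δ₂) (hδR : 0 ≤ δR)
    (hR1V : ∀ s, ‖RV s‖ ≤ ‖s‖) (dRV : ∀ s, ‖RkV s - RV s‖ ≤ ρ * ‖s‖)
    (hB : ∀ f, ‖B₂kV f - B₂k f‖ ≤ δ₂ * ‖f‖) (hRR : ∀ s, ‖RkV s - Rk s‖ ≤ δR * ‖s‖) (v : E) :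
    ‖RkV (B₂kV v) - Rk (B₂k v)‖ ≤ ((1 + ρ) * δ₂ + δR * (1 + CP + β)) * Real.sqrt (‖B₁ v‖ ^ 2 + ‖R (B₂ v)‖ ^ 2 + a * ‖Q v‖ ^ 2 + ‖v‖ ^ 2) := by
  have h1 := norm_B₂k_le_weightU B₁ B₂ R Q a β CP B₂k ha hβ hCP dB₂ hP (𝕜 := 𝕜) v
  have h2 := norm_le_weightU B₁ B₂ R Q a ha (𝕜 := 𝕜) v
  have hRkV : ∀ s, ‖RkV s‖ ≤ (1 + ρ) * ‖s‖ := fun s => by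
    have := norm_add_le (RV s) (RkV s - RV s); rw [add_sub_cancel] at this
    nlinarith [hR1V s, dRV s]
  have e : RkV (B₂kV v) - Rk (B₂k v) = RkV (B₂kV v - B₂k v) + (RkV (B₂k v) - Rk (B₂k v)) := by rw [map_sub]; abel
  rw [e]
  calc ‖RkV (B₂kV v - B₂k v) + (RkV (B₂k v) - Rk (B₂k v))‖ ≤ ‖RkV (B₂kV v - B₂k v)‖ + ‖RkV (B₂k v) - Rk (B₂k v)‖ := norm_add_le _ _
    _ ≤ (1 + ρ) * (δ₂ * ‖v‖) + δR * ‖B₂k v‖ := add_le_add ((hRkV _).trans (mul_le_mul_of_nonneg_left (hB v) (by linarith))) (hRR _)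
    _ ≤ (1 + ρ) * (δ₂ * Real.sqrt (‖B₁ v‖ ^ 2 + ‖R (B₂ v)‖ ^ 2 + a * ‖Q v‖ ^ 2 + ‖v‖ ^ 2)) +
        δR * ((1 + CP + β) * Real.sqrt (‖B₁ v‖ ^ 2 + ‖R (B₂ v)‖ ^ 2 + a * ‖Q v‖ ^ 2 + ‖v‖ ^ 2)) := by
        gcongr
    _ = ((1 + ρ) * δ₂ + δR * (1 + CP + β)) * Real.sqrt (‖B₁ v‖ ^ 2 + ‖R (B₂ v)‖ ^ 2 + a * ‖Q v‖ ^ 2 + ‖v‖ ^ 2) := by ring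

end LettersU

/-! ## §2 THE END: the two-background difference of the conjugated `Δ_a`-inverses from primitive letters -/

section End

variable {B₁U B₁V : E →ₗ[𝕜] P} {B₂U B₂V : E →ₗ[𝕜] S} {RU RV : S →ₗ[𝕜] S} {QU QV : E →ₗ[𝕜] F} {KU KV HU HV : E →ₗ[𝕜] E}
  {a γ β βK pK ρ CP : ℝ}
  {B₁kU B₁kV : E →ₗ[𝕜] P} {B₁k'U B₁k'V : P →ₗ[𝕜] E} {B₂kU B₂kV : E →ₗ[𝕜] S} {B₂k'U B₂k'V : S →ₗ[𝕜] E} {RkU RkV : S →ₗ[𝕜] S}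
  {QkU QkV : E →ₗ[𝕜] F} {Qk'U Qk'V : F →ₗ[𝕜] E} {KkU KkV HkU HkV GkU GkV : E →ₗ[𝕜] E}
  (ha : 0 ≤ a) (hγ : 0 < γ) (hβ : 0 ≤ β) (hρ : 0 ≤ ρ) (hρ8 : ρ ≤ 1 / 8) (hCP : 0 ≤ CP)
  (small' : 3 / 4 * pK + (21 + 3 * a) * β ^ 2 + 4 * β * CP + 2 * ρ * CP ^ 2 + βK ≤ γ / 8)
  -- the structure at `U`
  (hRsqU : ∀ s, RCLike.re ⟪s, RU s⟫_𝕜 = ‖RU s‖ ^ 2) (hR1U : ∀ s, ‖RU s‖ ≤ ‖s‖)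
  (hHU : ∀ f, HU f = LinearMap.adjoint B₁U (B₁U f) + LinearMap.adjoint B₂U (RU (B₂U f)) + KU f + ((a : ℝ) : 𝕜) • LinearMap.adjoint QU (QU f))
  (coerciveU : ∀ f, γ * ‖f‖ ^ 2 ≤ RCLike.re ⟪f, HU f⟫_𝕜) (hKreU : ∀ f, -(pK * ‖f‖ ^ 2) ≤ RCLike.re ⟪f, KU f⟫_𝕜)
  (hPU : ∀ f, ‖B₂U f - RU (B₂U f)‖ ≤ CP * ‖f‖)
  (dB₁U : ∀ f, ‖B₁kU f - B₁U f‖ ≤ β * ‖f‖) (dB₁'U : ∀ p, ‖B₁k'U p - LinearMap.adjoint B₁U p‖ ≤ β * ‖p‖)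
  (dB₂U : ∀ f, ‖B₂kU f - B₂U f‖ ≤ β * ‖f‖) (dB₂'U : ∀ s, ‖B₂k'U s - LinearMap.adjoint B₂U s‖ ≤ β * ‖s‖)
  (dRU : ∀ s, ‖RkU s - RU s‖ ≤ ρ * ‖s‖)
  (dQU : ∀ f, ‖QkU f - QU f‖ ≤ β * ‖f‖) (dQ'U : ∀ g, ‖Qk'U g - LinearMap.adjoint QU g‖ ≤ β * ‖g‖)
  (dKU : ∀ f, ‖KkU f - KU f‖ ≤ βK * ‖f‖)
  (hHkU : ∀ f, HkU f = B₁k'U (B₁kU f) + B₂k'U (RkU (B₂kU f)) + KkU f + ((a : ℝ) : 𝕜) • Qk'U (QkU f)) (hGU : ∀ v, HkU (GkU v) = v)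
  -- the structure at `V`
  (hRsqV : ∀ s, RCLike.re ⟪s, RV s⟫_𝕜 = ‖RV s‖ ^ 2) (hR1V : ∀ s, ‖RV s‖ ≤ ‖s‖)
  (hHV : ∀ f, HV f = LinearMap.adjoint B₁V (B₁V f) + LinearMap.adjoint B₂V (RV (B₂V f)) + KV f + ((a : ℝ) : 𝕜) • LinearMap.adjoint QV (QV f))
  (coerciveV : ∀ f, γ * ‖f‖ ^ 2 ≤ RCLike.re ⟪f, HV f⟫_𝕜) (hKreV : ∀ f, -(pK * ‖f‖ ^ 2) ≤ RCLike.re ⟪f, KV f⟫_𝕜)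
  (hPV : ∀ f, ‖B₂V f - RV (B₂V f)‖ ≤ CP * ‖f‖)
  (dB₁V : ∀ f, ‖B₁kV f - B₁V f‖ ≤ β * ‖f‖) (dB₁'V : ∀ p, ‖B₁k'V p - LinearMap.adjoint B₁V p‖ ≤ β * ‖p‖)
  (dB₂V : ∀ f, ‖B₂kV f - B₂V f‖ ≤ β * ‖f‖) (dB₂'V : ∀ s, ‖B₂k'V s - LinearMap.adjoint B₂V s‖ ≤ β * ‖s‖)
  (dRV : ∀ s, ‖RkV s - RV s‖ ≤ ρ * ‖s‖)
  (dQV : ∀ f, ‖QkV f - QV f‖ ≤ β * ‖f‖) (dQ'V : ∀ g, ‖Qk'V g - LinearMap.adjoint QV g‖ ≤ β * ‖g‖)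
  (dKV : ∀ f, ‖KkV f - KV f‖ ≤ βK * ‖f‖)
  (hHkV : ∀ f, HkV f = B₁k'V (B₁kV f) + B₂k'V (RkV (B₂kV f)) + KkV f + ((a : ℝ) : 𝕜) • Qk'V (QkV f)) (hGV : ∀ v, HkV (GkV v) = v)
  -- the CONJUGATED two-background difference letters (zeroth order at the lattice: «conjugate the difference»)
  {δ₁ δ₂ δR δQ δK : ℝ} (hδ₁ : 0 ≤ δ₁) (hδ₂ : 0 ≤ δ₂) (hδR : 0 ≤ δR) (hδQ : 0 ≤ δQ) (hδK : 0 ≤ δK)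
  (tB₁ : ∀ f, ‖B₁kV f - B₁kU f‖ ≤ δ₁ * ‖f‖) (tB₁' : ∀ p, ‖B₁k'V p - B₁k'U p‖ ≤ δ₁ * ‖p‖)
  (tB₂ : ∀ f, ‖B₂kV f - B₂kU f‖ ≤ δ₂ * ‖f‖) (tB₂' : ∀ s, ‖B₂k'V s - B₂k'U s‖ ≤ δ₂ * ‖s‖)
  (tR : ∀ s, ‖RkV s - RkU s‖ ≤ δR * ‖s‖)
  (tQ : ∀ f, ‖QkV f - QkU f‖ ≤ δQ * ‖f‖) (tQ' : ∀ g, ‖Qk'V g - Qk'U g‖ ≤ δQ * ‖g‖)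
  (tK : ∀ f, ‖KkV f - KkU f‖ ≤ δK * ‖f‖)
  -- the UNconjugated two-background difference letters (ZEROTH order; for the weight comparison)
  {d₁ d₂ dR dQ : ℝ} (hd₁ : 0 ≤ d₁) (hd₂ : 0 ≤ d₂) (hdR : 0 ≤ dR) (hdQ : 0 ≤ dQ)
  (uB₁ : ∀ f, ‖B₁U f - B₁V f‖ ≤ d₁ * ‖f‖) (uB₂ : ∀ f, ‖B₂U f - B₂V f‖ ≤ d₂ * ‖f‖) (uR : ∀ s, ‖RU s - RV s‖ ≤ dR * ‖s‖)
  (uQ : ∀ f, ‖QU f - QV f‖ ≤ dQ * ‖f‖)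

include ha hβ hρ hCP hR1U hPU dB₁U dB₁'U dB₂U dB₂'U dRU dQU dQ'U hHkU hR1V dRV hHkV hδ₁ hδ₂ hδR hδQ hδK tB₁ tB₁' tB₂ tB₂' tR tQ tQ' tK in
/-- **THE CONJUGATED TWO-BACKGROUND FORM DEFECT IN `N_U` FROM PRIMITIVE LETTERS**: with (CDA)'s conjugation letters at `U` (`β, ρ, C_P`), `V`'s projection
letters and the eight CONJUGATED two-background letters `δ₁, δ₂, δ_R, δ_Q, δ_K`:
`‖⟪u, H_κ(U)v⟫ − ⟪u, H_κ(V)v⟫‖ ≤ Θ·N_U(u)·N_U(v)` with the displayed `Θ` (`…FormDefect.norm_inner_conjH_sub_conjH_le` on §1's letters) — the `hT` binder of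
`…EnergyWeight.norm_rightInv_sub_rightInv_le` and the `hD` letter of the linear pencil `H_κ(U) + z(H_κ(V) − H_κ(U))`. [folklore]
[cite: Balaban1985BackgroundPropagators, (3.52)–(3.53) p.400, (3.84)–(3.86) p.407, (3.26) p.395, (3.49) p.399] -/
theorem norm_inner_conjH_sub_conjH_le_weightU (u v : E) :
    ‖⟪u, HkU v⟫_𝕜 - ⟪u, HkV v⟫_𝕜‖ ≤
      (((1 + β) * δ₁ + δ₁ * (1 + β) + δ₁ * δ₁) +
          ((1 + CP + β) * ((1 + ρ) * δ₂ + δR * (1 + CP + β)) + δ₂ * ((1 + ρ) * (1 + CP + β)) + δ₂ * ((1 + ρ) * δ₂ + δR * (1 + CP + β))) +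
          δK + ((Real.sqrt a + |a| * β) * δQ + δQ * (Real.sqrt a + |a| * β) + |a| * (δQ * δQ))) *
        Real.sqrt (‖B₁U u‖ ^ 2 + ‖RU (B₂U u)‖ ^ 2 + a * ‖QU u‖ ^ 2 + ‖u‖ ^ 2) * Real.sqrt (‖B₁U v‖ ^ 2 + ‖RU (B₂U v)‖ ^ 2 + a * ‖QU v‖ ^ 2 + ‖v‖ ^ 2) := by
  -- the letters of §1 in the weight `N_U`
  have hNU0 := weightU_nonneg B₁U B₂U RU QU a (𝕜 := 𝕜)
  have hNUn := norm_le_weightU B₁U B₂U RU QU a ha (𝕜 := 𝕜)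
  have s₁ := norm_B₁k_le_weightU B₁U B₂U RU QU a β B₁kU ha hβ dB₁U (𝕜 := 𝕜)
  have s₁' := norm_adjoint_B₁k'_le_weightU B₁U B₂U RU QU a β B₁k'U ha hβ dB₁'U
  have s₂ := norm_Rk_B₂k_le_weightU B₁U B₂U RU QU a β ρ CP B₂kU RkU ha hβ hρ hCP hR1U dB₂U dRU hPU (𝕜 := 𝕜)
  have s₂' := norm_adjoint_B₂k'_le_weightU B₁U B₂U RU QU a β CP B₂k'U ha hβ hCP dB₂'U hPU
  have sQ := abs_mul_norm_Qk_le_weightU B₁U B₂U RU QU a β QkU ha hβ dQU (𝕜 := 𝕜)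
  have sQ' := abs_mul_norm_adjoint_Qk'_le_weightU B₁U B₂U RU QU a β Qk'U ha hβ dQ'U
  have e₁ : ∀ v, ‖B₁kV v - B₁kU v‖ ≤ δ₁ * Real.sqrt (‖B₁U v‖ ^ 2 + ‖RU (B₂U v)‖ ^ 2 + a * ‖QU v‖ ^ 2 + ‖v‖ ^ 2) :=
    fun v => (tB₁ v).trans (mul_le_mul_of_nonneg_left (hNUn v) hδ₁)
  have e₁' : ∀ u, ‖LinearMap.adjoint B₁k'V u - LinearMap.adjoint B₁k'U u‖ ≤ δ₁ * Real.sqrt (‖B₁U u‖ ^ 2 + ‖RU (B₂U u)‖ ^ 2 + a * ‖QU u‖ ^ 2 + ‖u‖ ^ 2) :=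
    fun u => (norm_adjoint_sub_adjoint_le hδ₁ tB₁' u).trans (mul_le_mul_of_nonneg_left (hNUn u) hδ₁)
  have e₂ := norm_Rk_B₂k_sub_le_weightU B₁U B₂U RU QU a β ρ CP B₂kU RkU ha hβ hρ hCP dB₂U hPU (𝕜 := 𝕜) hδ₂ hδR hR1V dRV tB₂ tR
  have e₂' : ∀ u, ‖LinearMap.adjoint B₂k'V u - LinearMap.adjoint B₂k'U u‖ ≤ δ₂ * Real.sqrt (‖B₁U u‖ ^ 2 + ‖RU (B₂U u)‖ ^ 2 + a * ‖QU u‖ ^ 2 + ‖u‖ ^ 2) :=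
    fun u => (norm_adjoint_sub_adjoint_le hδ₂ tB₂' u).trans (mul_le_mul_of_nonneg_left (hNUn u) hδ₂)
  have eQ : ∀ v, ‖QkV v - QkU v‖ ≤ δQ * Real.sqrt (‖B₁U v‖ ^ 2 + ‖RU (B₂U v)‖ ^ 2 + a * ‖QU v‖ ^ 2 + ‖v‖ ^ 2) :=
    fun v => (tQ v).trans (mul_le_mul_of_nonneg_left (hNUn v) hδQ)
  have eQ' : ∀ u, ‖LinearMap.adjoint Qk'V u - LinearMap.adjoint Qk'U u‖ ≤ δQ * Real.sqrt (‖B₁U u‖ ^ 2 + ‖RU (B₂U u)‖ ^ 2 + a * ‖QU u‖ ^ 2 + ‖u‖ ^ 2) :=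
    fun u => (norm_adjoint_sub_adjoint_le hδQ tQ' u).trans (mul_le_mul_of_nonneg_left (hNUn u) hδQ)
  have eK : ∀ v, ‖KkV v - KkU v‖ ≤ δK * Real.sqrt (‖B₁U v‖ ^ 2 + ‖RU (B₂U v)‖ ^ 2 + a * ‖QU v‖ ^ 2 + ‖v‖ ^ 2) :=
    fun v => (tK v).trans (mul_le_mul_of_nonneg_left (hNUn v) hδK)
  exact norm_inner_conjH_sub_conjH_le hHkU hHkV (fun f => Real.sqrt (‖B₁U f‖ ^ 2 + ‖RU (B₂U f)‖ ^ 2 + a * ‖QU f‖ ^ 2 + ‖f‖ ^ 2)) hNU0 hNUn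
    (by positivity) (by positivity) (by positivity) hδ₁ hδ₂ hδQ s₁ s₁' s₂ s₂' sQ sQ' e₁ e₁' e₂ e₂' eQ eQ' eK u v

include ha hγ hβ hρ hρ8 hCP small' hRsqU hR1U hHU coerciveU hKreU hPU dB₁U dB₁'U dB₂U dB₂'U dRU dQU dQ'U dKU hHkU hGU hRsqV hR1V hHV coerciveV hKreV
  hPV dB₁V dB₁'V dB₂V dB₂'V dRV dQV dQ'V dKV hHkV hGV hδ₁ hδ₂ hδR hδQ hδK tB₁ tB₁' tB₂ tB₂' tR tQ tQ' tK hd₁ hd₂ hdR hdQ uB₁ uB₂ uR uQ in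
/-- **THE TWO-BACKGROUND DIFFERENCE OF THE CONJUGATED `Δ_a`-INVERSES FROM PRIMITIVE LETTERS.**  Two backgrounds `U, V` with `Δ_a`-structures
`H(X) = B₁(X)†B₁(X) + B₂(X)†R(X)B₂(X) + K(X) + aQ(X)†Q(X)` (`R(X)` orthogonal projections), both `γ`-coercive (Thm 3.11 — displayed) with the `Δ′`-floor `p_K` and
the complementary-projection bound `C_P`; their conjugates `H_κ(X) = B′_{1,κ}(X)B_{1,κ}(X) + B′_{2,κ}(X)R_κ(X)B_{2,κ}(X) + K_κ(X) + aQ′_κ(X)Q_κ(X)` within (CDA)'s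
letters `β, ρ ≤ 1∕8, β_K` of the unconjugated ones, on the ENERGY window `¾p_K + (21 + 3a)β² + 4βC_P + 2ρC_P² + β_K ≤ γ∕8`; right inverses `H_κ(X)G_κ(X) = 1`;
the CONJUGATED two-background letters `‖B_{i,κ}(V) − B_{i,κ}(U)‖, ‖B′_{i,κ}(V) − B′_{i,κ}(U)‖ ≤ δ_i`, `‖R_κ(V) − R_κ(U)‖ ≤ δ_R`, `‖Q_κ(V) − Q_κ(U)‖,
‖Q′_κ(V) − Q′_κ(U)‖ ≤ δ_Q`, `‖K_κ(V) − K_κ(U)‖ ≤ δ_K` and the UNconjugated ZEROTH-order ones `‖B₁(U) − B₁(V)‖ ≤ d₁`, `‖B₂(U) − B₂(V)‖ ≤ d₂`,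
`‖R(U) − R(V)‖ ≤ d_R`, `‖Q(U) − Q(V)‖ ≤ d_Q`.
THEN `‖G_κ(V)y − G_κ(U)y‖ ≤ (Θ∕γ′)·((1 + δ_N)·γ′⁻¹)·‖y‖` with `γ′ = min(¼, γ∕8)`, `δ_N = d₁ + d₂ + d_R(1 + C_P) + √a·d_Q` and the displayed `Θ` — LINEAR in
`(δ₁, δ₂, δ_R, δ_Q, δ_K)` at leading order, NO `η`, NO volume: `B9Eq326ConjugatedDeltaAEnergyWeight.norm_rightInv_sub_rightInv_le_of_coercive` with `coerciveN_k`
at `U` and at `V`, `…FormDefect.norm_inner_conjH_sub_conjH_le` on §1's letters, and `…FormDefect.weightU_le_weightV_mul`.  Uniformly on the Combes–Thomas circle this is the `hC` letter of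
`B9Eq349BondBlockDecayFromCircle.norm_bondBlock_le_exp_of_uniform_circle_bound` for `T := G₁,k(V) − G₁,k(U)` (t4-ne9-idea-1 g151's N52 road (α)). [folklore]
[cite: Balaban1985BackgroundPropagators, Thm 3.4 p.400, (3.52)–(3.53) p.400, (3.84)–(3.86) p.407, (3.26) p.395, (3.49) p.399, Thm 3.11 p.416; Balaban1985Variational, (110) p.294] -/
theorem norm_conjGk_sub_conjGk_le (y : E) :
    ‖GkV y - GkU y‖ ≤
      (((1 + β) * δ₁ + δ₁ * (1 + β) + δ₁ * δ₁) +
          ((1 + CP + β) * ((1 + ρ) * δ₂ + δR * (1 + CP + β)) + δ₂ * ((1 + ρ) * (1 + CP + β)) + δ₂ * ((1 + ρ) * δ₂ + δR * (1 + CP + β))) +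
          δK + ((Real.sqrt a + |a| * β) * δQ + δQ * (Real.sqrt a + |a| * β) + |a| * (δQ * δQ))) / min (1 / 4) (γ / 8) *
        ((1 + (d₁ + d₂ + dR * (1 + CP) + Real.sqrt a * dQ)) * (min (1 / 4) (γ / 8))⁻¹) * ‖y‖ := by
  have hγ' : 0 < min (1 / 4) (γ / 8) := lt_min (by norm_num) (by linarith)
  -- the two coercivities in their energy weights
  have hcoerU := coerciveN_k B₁U B₂U RU QU KU HU a γ β βK pK ρ CP B₁kU B₁k'U B₂kU B₂k'U RkU QkU Qk'U KkU HkU ha hβ hρ hCP hRsqU hR1U hHU coerciveU hKreU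
    dB₁U dB₁'U dB₂U dB₂'U dRU dQU dQ'U dKU small' hHkU hρ8 hPU
  have hcoerV := coerciveN_k B₁V B₂V RV QV KV HV a γ β βK pK ρ CP B₁kV B₁k'V B₂kV B₂k'V RkV QkV Qk'V KkV HkV ha hβ hρ hCP hRsqV hR1V hHV coerciveV hKreV
    dB₁V dB₁'V dB₂V dB₂'V dRV dQV dQ'V dKV small' hHkV hρ8 hPV
  -- the form defect in `N_U` (§1's letters through `…FormDefect.norm_inner_conjH_sub_conjH_le`)
  have hNU0 := weightU_nonneg B₁U B₂U RU QU a (𝕜 := 𝕜)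
  have hNUn := norm_le_weightU B₁U B₂U RU QU a ha (𝕜 := 𝕜)
  have hΘ := norm_inner_conjH_sub_conjH_le_weightU ha hβ hρ hCP hR1U hPU dB₁U dB₁'U dB₂U dB₂'U dRU dQU dQ'U hHkU hR1V dRV hHkV hδ₁ hδ₂ hδR hδQ hδK
    tB₁ tB₁' tB₂ tB₂' tR tQ tQ' tK
  -- the weight comparison
  have hcmp := weightU_le_weightV_mul ha hCP hd₁ hd₂ hdR hdQ hR1U hPV uB₁ uB₂ uR uQ (𝕜 := 𝕜)
  have hδN : 0 ≤ d₁ + d₂ + dR * (1 + CP) + Real.sqrt a * dQ := by positivity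
  exact norm_rightInv_sub_rightInv_le_of_coercive hGU hGV _ hNU0 hNUn hγ' (by positivity) hcoerU hΘ
    (fun f => Real.sqrt (‖B₁V f‖ ^ 2 + ‖RV (B₂V f)‖ ^ 2 + a * ‖QV f‖ ^ 2 + ‖f‖ ^ 2)) (norm_le_weightU B₁V B₂V RV QV a ha) hγ' hcoerV
    (weightU_nonneg B₁V B₂V RV QV a) hδN hcmp y

end End

end Literature.MathematicalPhysics.QuantumFieldTheory.Balaban1983to89.B9Eq326ConjugatedDeltaATwoBackgrounds

end
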